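import Literature.MathematicalPhysics.QuantumFieldTheory.Balaban1983to89.B6CubeInDecayV1
import Literature.MathematicalPhysics.QuantumFieldTheory.Balaban1983to89.B6Prop25HolderRateFreeV1

/-!
# `Balaban1983to89.B6HolderPairMemberV1` — T. Bałaban, *Propagators and renormalization transformations for lattice gauge theories. II*,
# Commun. Math. Phys. **96** (1984) 223–250 [Balaban1984PropagatorsII], Prop. 2.6 (2.137) p. 247 with Prop. 2.5 p. 246 / [4] (1.111) p. 35:
# THE HÖLDER FIRST LEG OF THE WALK (2.141) — STEP 1: THE MEMBER'S PAIR MAJORANT `P_{b₁,b₂}·∇_λG_□ ≤ C·t^α·e^{−δ₂(1−α)|y−y′|}` ON ITS OWN TORUS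
# `T_□` (p38's two-scale (1.111) member in r03's rate-free form `holderBound_DG_rateFree`, read as a `HasMajorant` of the pair-difference operator)
# AND THE TRANSPORT CALCULUS OF THE PAIR-DIFFERENCE OPERATOR (window transplant, torus translation, multiplications)

statement-level skeleton of published theorems with citation tags; proofs where landed; nothing here is a claim about the Yang–Mills mass gap

PDF held: `paper:balaban1984-cmp96-propagators-rt-ii` (journal page = PDF page + 222), p. 247 [PDF 25] (re-read this generation, ×2 render
`b2b-balaban-ref1/pages/1984-cmp96-propagators-rt-II/1984-cmp96-propagators-rt-II-p025-x2.png`): *"‖ζ∇GJ‖_α, ‖ζG∇*J‖_α ≤ O(1)(Lʲη)^{1−α}(‖ζ‖^ξ_α + |ζ|)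
e^{−δ₃d(y,y′)}|J|, ξ = L^{−j} (2.137)"*, *"G = … = Σ_ω h_{□₀}G_{□₀}h_{□₀}K_{□₁,□₂}… (2.141) and the series above is convergent in the norms appearing in the
inequalities (2.136)–(2.140)"*; p. 246 [PDF 24]: *"Proposition 2.5. The operator G_□ defined by (2.90) … satisfies all the inequalities (1.110)–(1.114) of the
Proposition 1.2 with a positive constant δ₂ instead of δ₀"*; [4] = *… I*, CMP **95** (1984) (1.111) p. 35: *"‖ζ∇GJ‖_α, ‖ζG∇*J‖_α ≤ O(1)e^{−δ₀|y−y′|}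
(‖ζ‖_α + |ζ|)|J|"*, (1.109): *"‖A‖_α = max_μ sup_{x,x′: |x−x′| ≤ 1} |x − x′|^{−α}|A_μ(x) − A_μ(x′)|"*.

CITATION HEADER (lean-in-tree rule) — WHAT IS REPRODUCED.  Phase-2 file of the `lit-balaban` typed skeleton (HOME `run/shared/lean/pub/lit-balaban/`),
seat **p22 gen 26** (free target (2.137)₁ at k levels, protocol G.5-34(d), TAKING HOME/STATUS.md 2026-08-23T22:15Z; r03 no objection 22:25Z); SKELETON
rows **B6.Prop2.6** × B6.Prop2.5 (cells only; decls of record untouched).  The Hölder column of the k-level walk needs, per cube, the first leg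
`P_{x,x′}·∇_ν(h_□G_□h_□)` (this seat's `…B6Prop26HolderGradKLevelV1`, hypothesis of `prop26_2137_grad_kLevel_of_legs`); like the sup legs (r03's
`…B6CubeInDecayV1.hEGin_cube` from p38's `…B6Ineq2133TwoScaleV1.ineq2133_DG`) it is the MEMBER estimate on `T_□` carried through r03's window
transplant and torus translation.  THIS FILE supplies the pair operator and the two member-side ingredients:
* §0 (generic lattice/geometry) **`pairOp x x′ := LinearMap.single ℝ _ x ∘ₗ (LinearMap.proj x − LinearMap.proj x′)`** (`(P_{x,x′}f)(z) = [z = x]·(f(x) −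
  f(x′))`, the numerator of the Hölder quotient (1.109) at ONE pair as a linear operator, so that `P_{x,x′}·∇_ν` is a LEFT FACTOR of the walk (2.141));
  `pairOp_apply`, `pairOp_mul_apply`, **`hasMajorant_pairOp_mul`** (a pair bound `|Tμ(x) − Tμ(x′)| ≤ K(y(x),y′)|μ|` for block-supported `μ` IS
  `HasMajorant (P_{x,x′}·T) K`, `K ≥ 0`), **`pairDiff_le_of_hasMajorant`** (converse), `abs_cutoff_pair_le` (the product rule
  `|ζ(x)F(x) − ζ(x′)F(x′)| ≤ |ζ(x′)|·|F(x) − F(x′)| + |ζ(x) − ζ(x′)|·|F(x)|` behind print's factor `(‖ζ‖_α + |ζ|)`);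
* §1 **`hasMajorant_pairOp_of_holderBound`** — the Hölder twin of p38's `…B6Ineq2133TwoScaleV1.hasMajorant_of_blockBound`: a PAIR block bound
  `Σ_{b′ : y(b′₋) = y′}|f(e_{b′})_{b₁} − f(e_{b′})_{b₂}| ≤ C·e^{−δ|y(b₁₋) − y′|_T}` of an operator `f` of the member's bond space gives
  `HasMajorant (tsGeo i) (y(·₋)) (P_{b₁,b₂}·onFun f) (C·e^{−δ|y − y′|_T})` (p38's `pairDiff_eq_sum` + `abs_sum_mul_le_of_fiberBound`; the bound written, as in p38's files, with the classical decidability instance for `e_{b′}`);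
  **`holder2137_member`** — [4] (1.111), member `‖ζ∇GJ‖_α`, FOR THE GENUINE TWO-SCALE `G_□` (p38's `…B6Prop25HolderTwoScaleV1.holderBound_DG_scaling`
  in r03's RATE-FREE form `…B6Prop25HolderRateFreeV1.holderBound_DG_rateFree`, BY NAME) in that shape: there is `δ₂ > 0` and for every `0 ≤ α < 1` a
  `C_α ≥ 0` (on `d, L, a₀, a₁, α`) such that for every member `i`, direction `λ` and fine bonds `b₁, b₂` of `T_□` of the same direction with
  `|b₁₋ − b₂₋|_∞ ≤ Lʲ`: `HasMajorant (tsGeo i R M) (y(·₋)) (P_{b₁,b₂}·onFun(∇_λ∘G_□)) (C_α·t^α·e^{−δ₂|y − y′|_T})`, `t = |b₁₋ − b₂₋|_∞/Lʲ` — the input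
  of r03's generic `…B6InDecayWindowV1.inDecay_window_V1` (any member operator `T′`); **`holderG_member`** — the Lipschitz pair majorant of `G_□`
  itself, `C·t·e^{−δ₂|y−y′|_T}`, from p22's block bounds of all `∇_μG_□` (`blockBound_DG_scaling`, (1.110)₂) telescoped by p38's
  `…B6BlockHolderLipschitzV1.holderBound_of_blockBound_D` (the input of the leg's `(∇h_□)·G_□·h_□` term);
* §2 (generic lattices) THE TRANSPORT CALCULUS OF `P_{x,x′}`: **`transplant_pairOp_mul`** (`ε(P_{e c₁, e c₂}·T′)ρ = P_{c₁,c₂}·(εT′ρ)` for window bonds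
  `c₁, c₂` and a chart injective on the window), **`TB_neg_mul_pairOp_mul_TB`** (`τ_{−v}P_{c₁,c₂}τ_v = P_{c₁+v, c₂+v}`), **`pairOp_mul_mulOp`**
  (`P_{x,x′}·(f·) = f(x′)•P_{x,x′} + (f(x) − f(x′))•(1_x·)`: the product rule at one pair), `pairOp_mul_smul`.
IMPORTS BY NAME, restating nothing; ONE definition with body (`pairOp`, §0), theorems otherwise; no `def … : Prop`, no new hypothesis; standard axioms.

HONEST SCOPE / DIVERGENCES.  (1) §1 is p38's/r03's two-scale theorem re-read, with ITS scope: rate `δ₂(d, L, a₀, a₁)` independent of `α` (as printed),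
constant `C_α` on `d, L, a₀, a₁, α`, pairs of the same direction at sup-distance `≤ Lʲ` (`t ≤ 1`).  (2) The cube-level Hölder leg (window
transplant of §1, the product rule with `h_□` — which needs the mixed second differences of the fine partition — and the gap lemma placing the output
block in `□̃`) and the hypothesis-free (2.137)₁ are the NEXT files of this seat; nothing here touches the k-level `G`.  Integer tori, lattice units;
nothing on d = 4 specifically or the continuum; NOT summit progress.  Unit `lit-balaban-p22` (gen 26), 2026-08-23.
-/

open scoped BigOperators
open Finset

namespace Literature.MathematicalPhysics.QuantumFieldTheory.Balaban1983to89.B6HolderPairMemberV1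

open LatticeFieldCalculus
open B5Eq118OneStroke (iterBlockOf)
open BalabanImbrieJaffe1984to88.BIJ85AxialPropagator411 (BondSpace)
open B6RandomWalk (HasMajorant hasMajorant_mono BlockSupp)
open B6Prop26Gluing (mulOp mulOp_apply)
open B6Ineq2133TwoScaleV1 (onFun onFun_apply tsGeo)
open B6Prop25TwoScaleCensus (TSIdx)
open B6BlockHolderCalculus (pairDiff_eq_sum abs_sum_mul_le_of_fiberBound)
open B6Prop25HolderRateFreeV1 (holderBound_DG_rateFree)
open B6Prop25GradDecayTwoScaleV1 (blockBound_DG_scaling)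
open B6BlockHolderLipschitzV1 (holderBound_of_blockBound_D)
open B6SectCTwoScaleV1Lattice (tsV1)
open B6Prop26ReachTransplant (transplant restrictOp extendOp transplant_apply restrictOp_apply_of_injOn)
open B6TranslateTorusV1 (TB TB_apply)

noncomputable section

/-! ## §0  The pair-difference operator `P_{x,x′} = e_x ⊗ (δ_x − δ_{x′})`, its majorant dictionary and the product rule of the cut-off -/

section Pair

variable {g : B6.Geometry} {X : Type}

/-- **THE PRODUCT RULE OF THE CUT-OFF** behind print's factor `(‖ζ‖_α + |ζ|)`: `|ζ(x)F(x) − ζ(x′)F(x′)| ≤ |ζ(x′)|·|F(x) − F(x′)| + |ζ(x) − ζ(x′)|·|F(x)|`.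
[cite: Balaban1984PropagatorsII, (2.137) p.247; [folklore] algebra] -/
theorem abs_cutoff_pair_le (ζ F : X → ℝ) (x x' : X) : |ζ x * F x - ζ x' * F x'| ≤ |ζ x'| * |F x - F x'| + |ζ x - ζ x'| * |F x| := by
  have e : ζ x * F x - ζ x' * F x' = ζ x' * (F x - F x') + (ζ x - ζ x') * F x := by ring
  rw [e, ← abs_mul, ← abs_mul]
  exact abs_add_le _ _

variable [DecidableEq X]

/-- **THE PAIR-DIFFERENCE OPERATOR `P_{x,x′} := e_x ⊗ (δ_x − δ_{x′})`** on functions on a (finite) lattice `X`: `(P_{x,x′}f)(z) = f(x) − f(x′)` at `z = x`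
and `0` elsewhere — the numerator of the Hölder quotient (1.109) *"‖A‖_α = max_μ sup_{x,x′: |x−x′| ≤ 1} |x − x′|^{−α}|A_μ(x) − A_μ(x′)|"* at ONE pair,
written as a linear operator so that `P_{x,x′}·∇_ν` is a left factor of the walk (2.141) (Mathlib's `LinearMap.single`/`LinearMap.proj`).
[cite: Balaban1984PropagatorsI, (1.109) p.35; Balaban1984PropagatorsII, (2.137) p.247 (operator reading ours)] -/
def pairOp (x x' : X) : Module.End ℝ (X → ℝ) :=
  LinearMap.single ℝ (fun _ : X => ℝ) x ∘ₗ ((LinearMap.proj x : (X → ℝ) →ₗ[ℝ] ℝ) - LinearMap.proj x')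

/-- `(P_{x,x′}f)(z) = [z = x]·(f(x) − f(x′))`. [cite: Balaban1984PropagatorsI, (1.109) p.35; bookkeeping ours] -/
@[simp] theorem pairOp_apply (x x' : X) (f : X → ℝ) (z : X) : pairOp x x' f z = if z = x then f x - f x' else 0 := by
  simp only [pairOp, LinearMap.coe_comp, Function.comp_apply, LinearMap.sub_apply, LinearMap.coe_proj, Function.eval,
    LinearMap.coe_single, Pi.single_apply]

/-- `(P_{x,x′}T)μ` is supported at `x` with value `(Tμ)(x) − (Tμ)(x′)`. [cite: Balaban1984PropagatorsI, (1.109) p.35; bookkeeping ours] -/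
theorem pairOp_mul_apply (x x' : X) (T : Module.End ℝ (X → ℝ)) (μ : X → ℝ) (z : X) :
    (pairOp x x' * T) μ z = if z = x then T μ x - T μ x' else 0 := by
  rw [Module.End.mul_apply, pairOp_apply]

/-- **A PAIR (HÖLDER-IN-THE-OUTPUT) BOUND IS A MAJORANT OF `P_{x,x′}·T`**: if `|Tμ(x) − Tμ(x′)| ≤ K(y(x), y′)·B` for every `μ` supported in the block `y′`
with `|μ| ≤ B`, and `K ≥ 0`, then `HasMajorant (P_{x,x′}·T) K`. [cite: Balaban1984PropagatorsII, (2.137) p.247 with [4] (1.109) p.35; bookkeeping ours] -/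
theorem hasMajorant_pairOp_mul (blk : X → g.Site) (x x' : X) {T : Module.End ℝ (X → ℝ)} {K : g.Site → g.Site → ℝ} (hK : ∀ a b, 0 ≤ K a b)
    (h : ∀ (y' : g.Site) (μ : X → ℝ) (B : ℝ), BlockSupp blk μ y' B → |T μ x - T μ x'| ≤ K (blk x) y' * B) :
    HasMajorant blk (pairOp x x' * T) K := by
  intro y' μ B hμ z
  rw [pairOp_mul_apply]
  split_ifs with hz
  · subst hz; exact h y' μ B hμ
  · rw [abs_zero]; exact mul_nonneg (hK _ _) hμ.nonneg

/-- **… AND CONVERSELY**: a majorant `K` of `P_{x,x′}·T` bounds the pair difference: `|Tμ(x) − Tμ(x′)| ≤ K(y(x), y′)·B`.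
[cite: Balaban1984PropagatorsII, (2.137) p.247 with [4] (1.109) p.35; bookkeeping ours] -/
theorem pairDiff_le_of_hasMajorant (blk : X → g.Site) (x x' : X) {T : Module.End ℝ (X → ℝ)} {K : g.Site → g.Site → ℝ}
    (h : HasMajorant blk (pairOp x x' * T) K) (y' : g.Site) (μ : X → ℝ) (B : ℝ) (hμ : BlockSupp blk μ y' B) :
    |T μ x - T μ x'| ≤ K (blk x) y' * B := by
  have := h y' μ B hμ x
  rwa [pairOp_mul_apply, if_pos rfl] at this

end Pair

/-! ## §1  The member's pair majorant: [4] (1.111) for the genuine two-scale `G_□` as `HasMajorant (P_{b₁,b₂}·∇_λG_□)` -/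

section Member

variable {d L : ℕ} {hd : 1 ≤ d + 1} {hL : Odd L ∧ 1 < L} {a₀ a₁ : ℝ}

/-- **PAIR BLOCK BOUND ⇒ PAIR MAJORANT** (the Hölder twin of p38's `hasMajorant_of_blockBound`): if the operator `f` of the member's bond space has the
pair block bound `Σ_{b′ : y(b′₋) = y′}|f(e_{b′})_{b₁} − f(e_{b′})_{b₂}| ≤ C·e^{−δ|y(b₁₋) − y′|_T}` (`C ≥ 0`), then `P_{b₁,b₂}·onFun f` has the majorant
`C·e^{−δ|y − y′|_T}` on `tsGeo i R M`: `|(fμ)(b₁) − (fμ)(b₂)| ≤ C·e^{−δ|y(b₁₋) − y′|_T}·B` for `μ` supported in the block `y′` with `|μ| ≤ B`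
(p38's `pairDiff_eq_sum` + `abs_sum_mul_le_of_fiberBound`).
[cite: Balaban1984PropagatorsI, (1.109), (1.111) p.35; Balaban1984PropagatorsII, (2.133) p.247 (shape; derivation ours)] -/
theorem hasMajorant_pairOp_of_holderBound (i : TSIdx d L hd hL a₀ a₁) (R M : ℝ) (f : BondSpace i.P →ₗ[ℝ] BondSpace i.P) (b₁ b₂ : PBond i.P 0)
    {C δ : ℝ} (hC : 0 ≤ C)
    (hf : ∀ y : Site i.P i.j, ∑ b' ∈ univ.filter (fun b' : PBond i.P 0 => iterBlockOf i.j b'.src = y),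
      |f (EuclideanSpace.single b' (1 : ℝ)) b₁ - f (EuclideanSpace.single b' (1 : ℝ)) b₂| ≤ C * Real.exp (-(δ * i.tdist (iterBlockOf i.j b₁.src) y))) :
    HasMajorant (g := tsGeo i R M) (fun b : PBond i.P 0 => iterBlockOf i.j b.src) (pairOp b₁ b₂ * onFun f)
      (fun y y' => C * Real.exp (-(δ * i.tdist y y'))) := by
  classical
  refine hasMajorant_pairOp_mul _ b₁ b₂ (fun a b => by positivity) fun y' μ B hμ => ?_
  have hg0 : ∀ y : Site i.P i.j, 0 ≤ (if y = y' then B else 0) := fun y => by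
    split_ifs
    · exact hμ.nonneg
    · exact le_rfl
  have hxg : ∀ b' : PBond i.P 0, |(WithLp.toLp 2 μ : BondSpace i.P) b'| ≤ (if iterBlockOf i.j b'.src = y' then B else 0) := fun b' => by
    by_cases hb : iterBlockOf i.j b'.src = y'
    · rw [if_pos hb]; exact hμ.bound b' hb
    · rw [if_neg hb, PiLp.toLp_apply, hμ.off b' hb, abs_zero]
  rw [onFun_apply, onFun_apply, pairDiff_eq_sum]
  have key := abs_sum_mul_le_of_fiberBound (ρ := i.tdist)
    (fun b' : PBond i.P 0 => f (EuclideanSpace.single b' (1 : ℝ)) b₁ - f (EuclideanSpace.single b' (1 : ℝ)) b₂)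
    (fun b : PBond i.P 0 => iterBlockOf i.j b.src) (iterBlockOf i.j b₁.src) hf (WithLp.toLp 2 μ) (fun y => if y = y' then B else 0) hg0 hxg
  refine key.trans (le_of_eq ?_)
  simp_rw [mul_ite, mul_zero, Finset.sum_ite_eq', Finset.mem_univ, if_true]
  ring

/-- the same with the pair block bound written, as in p38's two-scale files (`open Classical`), with the classical decidability instance for the unit
vectors `e_{b′}` — the entries `f(e_{b′})` do not depend on that instance (a subsingleton). [cite: Balaban1984PropagatorsI, (1.109) p.35; bookkeeping ours] -/
theorem hasMajorant_pairOp_of_holderBound_classical (i : TSIdx d L hd hL a₀ a₁) (R M : ℝ) (f : BondSpace i.P →ₗ[ℝ] BondSpace i.P)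
    (b₁ b₂ : PBond i.P 0) {C δ : ℝ} (hC : 0 ≤ C)
    (hf : ∀ y : Site i.P i.j, ∑ b' ∈ univ.filter (fun b' : PBond i.P 0 => iterBlockOf i.j b'.src = y),
      |f (@EuclideanSpace.single (PBond i.P 0) ℝ _ (fun a b => Classical.propDecidable (a = b)) b' (1 : ℝ)) b₁ -
        f (@EuclideanSpace.single (PBond i.P 0) ℝ _ (fun a b => Classical.propDecidable (a = b)) b' (1 : ℝ)) b₂| ≤
        C * Real.exp (-(δ * i.tdist (iterBlockOf i.j b₁.src) y))) :
    HasMajorant (g := tsGeo i R M) (fun b : PBond i.P 0 => iterBlockOf i.j b.src) (pairOp b₁ b₂ * onFun f)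
      (fun y y' => C * Real.exp (-(δ * i.tdist y y'))) := by
  have hd : @Eq (DecidableEq (PBond i.P 0)) (fun a b => Classical.propDecidable (a = b)) (inferInstanceAs (DecidableEq (PBond i.P 0))) :=
    Subsingleton.elim _ _
  rw [hd] at hf
  exact hasMajorant_pairOp_of_holderBound i R M f b₁ b₂ hC hf

open Classical in
/-- **[4] (1.111), MEMBER `‖ζ∇GJ‖_α`, FOR THE GENUINE TWO-SCALE `G_□` OF (2.90) AS A PAIR MAJORANT ON `T_□`** (p38's `holderBound_DG_scaling` in r03's
rate-free form `holderBound_DG_rateFree`, BY NAME; Prop. 2.5's *"(1.111) with δ₂ instead of δ₀"*): there is `δ₂ > 0` and for every `0 ≤ α < 1` a constant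
`C_α ≥ 0` (on `d, L, a₀, a₁, α`) such that for every member `i` of the two-scale family, direction `λ`, and fine bonds `b₁, b₂` of the same direction
with `|b₁₋ − b₂₋|_∞ ≤ Lʲ`: `HasMajorant (tsGeo i R M) (y(·₋)) (P_{b₁,b₂}·onFun(∇_λ∘G_□)) (C_α·(|b₁₋ − b₂₋|_∞/Lʲ)^α·e^{−δ₂|y − y′|_T})` — i.e.
`|(∇_λG_□μ)(b₁) − (∇_λG_□μ)(b₂)| ≤ C_α t^α e^{−δ₂|y(b₁₋) − y′|_T}|μ|` for `μ` supported in the block `y′`.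
[cite: Balaban1984PropagatorsII, Prop. 2.5 p.246, (2.133) p.247; Balaban1984PropagatorsI, (1.111), (1.109) p.35] -/
theorem holder2137_member (d L : ℕ) (hd : 1 ≤ d + 1) (hL : Odd L ∧ 1 < L) {a₀ a₁ : ℝ} (ha₀ : 0 < a₀) (ha₁ : a₀ ≤ a₁) :
    ∃ δ : ℝ, 0 < δ ∧ ∀ α : ℝ, 0 ≤ α → α < 1 → ∃ C : ℝ, 0 ≤ C ∧ ∀ (i : TSIdx d L hd hL a₀ a₁) (R M : ℝ) (lam : Fin i.P.d)
      (b₁ b₂ : PBond i.P 0), b₁.dir = b₂.dir → supDist b₁.src b₂.src ≤ L ^ i.j →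
      HasMajorant (g := tsGeo i R M) (fun b : PBond i.P 0 => iterBlockOf i.j b.src) (pairOp b₁ b₂ * onFun (i.Dl lam ∘ₗ i.D.G))
        (fun y y' => C * (((supDist b₁.src b₂.src : ℕ) : ℝ) / (L : ℝ) ^ i.j) ^ α * Real.exp (-(δ * i.tdist y y'))) := by
  obtain ⟨δ, hδ, h⟩ := holderBound_DG_rateFree d L hd hL ha₀ ha₁
  refine ⟨δ, hδ, fun α hα0 hα1 => ?_⟩
  obtain ⟨C, hC, hC'⟩ := h α hα0 hα1
  refine ⟨C, hC, fun i R M lam b₁ b₂ hdir hle => ?_⟩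
  have ht : 0 ≤ C * (((supDist b₁.src b₂.src : ℕ) : ℝ) / (L : ℝ) ^ i.j) ^ α :=
    mul_nonneg hC (Real.rpow_nonneg (by positivity) _)
  exact hasMajorant_pairOp_of_holderBound_classical i R M (i.Dl lam ∘ₗ i.D.G) b₁ b₂ ht fun y =>
    hC' i.m i.K i.j i.hc i.hj i.Λ' i.w i.hw0 i.hw1 lam b₁ b₂ hdir hle y

/-- **THE PAIR MAJORANT OF `G_□` ITSELF (LIPSCHITZ IN THE OUTPUT)** — p22's block bounds of ALL the fine differences `∇_μG_□`
(`…B6Prop25GradDecayTwoScaleV1.blockBound_DG_scaling`, Prop. 2.5 (1.110)₂) telescoped along lattice paths by p38's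
`…B6BlockHolderLipschitzV1.holderBound_of_blockBound_D`: there are `δ₂ > 0`, `C ≥ 0` (on `d, L, a₀, a₁`) such that for every member `i` and fine bonds
`b₁, b₂` of the same direction with `|b₁₋ − b₂₋|_∞ ≤ Lʲ`: `HasMajorant (tsGeo i R M) (y(·₋)) (P_{b₁,b₂}·onFun G_□) (C·t·e^{−δ₂|y − y′|_T})`,
`t = |b₁₋ − b₂₋|_∞/Lʲ` — the input of the leg's `(∇h_□)·G_□·h_□` term. [cite: Balaban1984PropagatorsII, Prop. 2.5 p.246, (2.133) p.247; Balaban1984PropagatorsI, (1.110) p.35] -/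
theorem holderG_member (d L : ℕ) (hd : 1 ≤ d + 1) (hL : Odd L ∧ 1 < L) {a₀ a₁ : ℝ} (ha₀ : 0 < a₀) (ha₁ : a₀ ≤ a₁) :
    ∃ δ : ℝ, 0 < δ ∧ ∃ C : ℝ, 0 ≤ C ∧ ∀ (i : TSIdx d L hd hL a₀ a₁) (R M : ℝ) (b₁ b₂ : PBond i.P 0), b₁.dir = b₂.dir →
      supDist b₁.src b₂.src ≤ L ^ i.j →
      HasMajorant (g := tsGeo i R M) (fun b : PBond i.P 0 => iterBlockOf i.j b.src) (pairOp b₁ b₂ * onFun i.D.G)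
        (fun y y' => C * (((supDist b₁.src b₂.src : ℕ) : ℝ) / (L : ℝ) ^ i.j) * Real.exp (-(δ * i.tdist y y'))) := by
  obtain ⟨δ, hδ, C, hC, h⟩ := blockBound_DG_scaling d L hd hL ha₀ ha₁
  refine ⟨δ, hδ, ((d + 1 : ℕ) : ℝ) * C * Real.exp δ, by positivity, fun i R M b₁ b₂ hdir hle => ?_⟩
  have hD := fun (lam : Fin (d + 1)) (b₀ : PBond i.P 0) (y : Site i.P i.j) => h i.m i.K i.j i.hc i.hj i.Λ' i.w i.hw0 i.hw1 lam b₀ y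
  have hd' : @Eq (DecidableEq (PBond i.P 0)) (fun a b => Classical.propDecidable (a = b)) (inferInstanceAs (DecidableEq (PBond i.P 0))) :=
    Subsingleton.elim _ _
  rw [hd'] at hD
  have ht : 0 ≤ ((d + 1 : ℕ) : ℝ) * C * Real.exp δ * (((supDist b₁.src b₂.src : ℕ) : ℝ) / (L : ℝ) ^ i.j) := by positivity
  refine hasMajorant_pairOp_of_holderBound i R M i.D.G b₁ b₂ ht fun y => ?_
  exact holderBound_of_blockBound_D (Nat.le_of_succ_le i.hj) (tsV1 (P := i.P) i.hc i.Λ' i.w).G (fun b : PBond i.P 0 => iterBlockOf i.j b.src) hC hδ.le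
    hD b₁ b₂ hdir hle y

end Member

/-! ## §2  The transport calculus of the pair-difference operator -/

section Transport

variable {X X' : Type} [DecidableEq X] [DecidableEq X']

/-- **`P` THROUGH THE WINDOW TRANSPLANT**: for window bonds `c₁, c₂ ∈ W` and a chart `e` injective on `W`,
`ε·(P_{e c₁, e c₂}·T′)·ρ = P_{c₁,c₂}·(ε·T′·ρ)` — the member's pair difference at `(e c₁, e c₂)` IS the global pair difference at `(c₁, c₂)` of the
transplanted operator. [cite: Balaban1984PropagatorsII, p.238 (T_□ = □̃³), (2.133) p.247; dictionary (charts), derivation ours] -/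
theorem transplant_pairOp_mul (W : Finset X) (e : X → X') (hinj : Set.InjOn e ↑W) (T' : Module.End ℝ (X' → ℝ)) {c₁ c₂ : X} (hc₁ : c₁ ∈ W)
    (hc₂ : c₂ ∈ W) : transplant W e (pairOp (e c₁) (e c₂) * T') = pairOp c₁ c₂ * transplant W e T' := by
  apply LinearMap.ext; intro f; funext x
  rw [transplant_apply, pairOp_mul_apply, pairOp_mul_apply, transplant_apply, transplant_apply, if_pos hc₁, if_pos hc₂]
  by_cases hx : x ∈ W
  · rw [if_pos hx]
    by_cases hxc : x = c₁
    · subst hxc; rw [if_pos rfl, if_pos rfl]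
    · have hne : e x ≠ e c₁ := fun h => hxc (hinj hx hc₁ h)
      rw [if_neg hne, if_neg hxc]
  · have hxc : x ≠ c₁ := fun h => hx (h ▸ hc₁)
    rw [if_neg hx, if_neg hxc]

variable {P : Params}

/-- **`P` UNDER THE TORUS TRANSLATION**: `τ_{−v}·P_{c₁,c₂}·τ_v = P_{c₁+v, c₂+v}` (`(τ_vf)(b) = f(b + v)`).
[cite: Balaban1983RegularityDecay, p.572 («T_η … with periodic conditions»); dictionary, derivation ours] -/
theorem TB_neg_mul_pairOp_mul_TB (v : Site P 0) (c₁ c₂ : PBond P 0) :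
    TB (-v) * pairOp c₁ c₂ * TB v = pairOp (c₁.translate v) (c₂.translate v) := by
  apply LinearMap.ext; intro f; funext x
  rw [Module.End.mul_apply, Module.End.mul_apply, TB_apply, pairOp_apply, pairOp_apply, TB_apply, TB_apply]
  have hiff : x.translate (-v) = c₁ ↔ x = c₁.translate v := by
    constructor
    · intro h; rw [← h, PBond.translate_translate, neg_add_cancel]; cases x; simp [PBond.translate]
    · intro h; rw [h, PBond.translate_translate, add_neg_cancel]; cases c₁; simp [PBond.translate]
  by_cases hx : x = c₁.translate v
  · rw [if_pos (hiff.2 hx), if_pos hx]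
  · rw [if_neg (fun h => hx (hiff.1 h)), if_neg hx]

omit [DecidableEq X'] in
/-- **THE PRODUCT RULE AT ONE PAIR**: `P_{x,x′}·(f·) = f(x′)•P_{x,x′} + (f(x) − f(x′))•(1_x·)` — `f(x)T(x) − f(x′)T(x′) = f(x′)(T(x) − T(x′)) +
(f(x) − f(x′))T(x)` written for the multiplication operator `mulOp f` (`1_x· = mulOp (Pi.single x 1)`).
[cite: Balaban1984PropagatorsII, (2.137) p.247 (the factor (‖ζ‖_α + |ζ|)); [folklore] algebra] -/
theorem pairOp_mul_mulOp (x x' : X) (f : X → ℝ) :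
    pairOp x x' * mulOp f = f x' • pairOp x x' + (f x - f x') • mulOp (Pi.single x (1 : ℝ)) := by
  apply LinearMap.ext; intro g; funext z
  rw [pairOp_mul_apply, LinearMap.add_apply, LinearMap.smul_apply, LinearMap.smul_apply, Pi.add_apply, Pi.smul_apply, Pi.smul_apply,
    pairOp_apply, mulOp_apply, mulOp_apply, mulOp_apply, Pi.single_apply, smul_eq_mul, smul_eq_mul]
  by_cases hz : z = x
  · subst hz; rw [if_pos rfl, if_pos rfl, if_pos rfl]; ring
  · rw [if_neg hz, if_neg hz, if_neg hz]; ring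

omit [DecidableEq X'] in
/-- `1_x·` followed by anything is read at `x` only: `((1_x·)T)μ(z) = [z = x]·(Tμ)(x)` (the second summand of the product rule at one pair).
[cite: Balaban1984PropagatorsII, (2.137) p.247; bookkeeping ours] -/
theorem mulOp_single_mul_apply (x : X) (T : Module.End ℝ (X → ℝ)) (μ : X → ℝ) (z : X) :
    (mulOp (Pi.single x (1 : ℝ)) * T) μ z = if z = x then T μ x else 0 := by
  rw [Module.End.mul_apply, mulOp_apply, Pi.single_apply]
  by_cases hz : z = x
  · subst hz; rw [if_pos rfl, if_pos rfl, one_mul]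
  · rw [if_neg hz, if_neg hz, zero_mul]

omit [DecidableEq X'] in
/-- **A SUP MAJORANT READ AT ONE POINT**: if `T` has the majorant `K ≥ 0` then so has `(1_x·)·T` (its only output is `(Tμ)(x)`).
[cite: Balaban1984PropagatorsII, (2.136)–(2.137) p.247; bookkeeping ours] -/
theorem hasMajorant_single_mul {g : B6.Geometry} (blk : X → g.Site) (x : X) {T : Module.End ℝ (X → ℝ)} {K : g.Site → g.Site → ℝ}
    (hK : ∀ a b, 0 ≤ K a b) (h : HasMajorant blk T K) : HasMajorant blk (mulOp (Pi.single x (1 : ℝ)) * T) K := by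
  intro y' μ B hμ z
  rw [mulOp_single_mul_apply]
  split_ifs with hz
  · subst hz; exact h y' μ B hμ z
  · rw [abs_zero]; exact mul_nonneg (hK _ _) hμ.nonneg

end Transport

end

end Literature.MathematicalPhysics.QuantumFieldTheory.Balaban1983to89.B6HolderPairMemberV1
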